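import Literature.AnabelianGeometry.Anabelioids.Basic
import Mathlib.CategoryTheory.Galois.Examples
import Mathlib.Topology.Algebra.ClopenNhdofOne
import Mathlib.Topology.Algebra.OpenSubgroup
import Mathlib.Tactic.Group
import HarnessLib

/-!
# Anabelioids: proof of the named fact `bCat_isSlim_iff_isSlimGroup` of `Anabelioids/Basic.lean`

Mochizuki, *Semi-graphs of anabelioids*, Publ. RIMS **42** (2006), §0 p. 6
[cite: MochizukiSemiAnbd2006, §0 p.6]: "`B(G)` is slim [every `B(G)_A → B(G)` is a rigid
functor] if and only if, for every open subgroup `H ⊆ G`, we have `Z_G(H) = {1}`" (`G`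
profinite).  The statement file `Literature.AnabelianGeometry.Anabelioids.Basic` records this as
the named fact `bCat_isSlim_iff_isSlimGroup`; this proof-only companion discharges it
(`bCat_isSlim_iff_isSlimGroup_holds`).

* (⇐) Let `α` be an automorphism of the forgetful functor `B(G)_A → B(G)`.  Naturality along the
  orbit maps `G/K → B`, `gK ↦ g b` (`K ⊆ Stab(b)` open normal) shows that `α` acts on each point
  `b` through its action on the pointed coset objects `(G/K, eK ↦ a)` over `A`, where
  `α(eK) = n_K K`.  The closed cosets `n_K K` form a directed family (naturality along the
  projections `G/K' → G/K`), so by compactness some `n` lies in all of them; naturality along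
  right multiplication by `x ∈ Stab(a)` gives `[n, x] ∈ K` for all such `K`, whence (open
  subgroups separate points) `n ∈ Z_G(Stab(a)) = {1}` and every `α(eK) = eK`.
* (⇒) For `z ∈ Z_G(H)`, `b ↦ (g z g⁻¹) · b` (`b ↦ gH` the structure map to `A = G/H`) is a
  natural automorphism of `B(G)_A → B(G)`, nontrivial on `(G/K → G/H)` as soon as `z ∉ K`.

Proof-only: no definitions, nothing of the statement file is restated; the coset objects are
Mathlib's `G ⧸ₐ K`.
-/

namespace Literature.AnabelianGeometry.Anabelioids

open CategoryTheory CategoryTheory.Limits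
open Literature.AlgebraicGeometry.Frobenioids (BCat IsSlimGroup)
open scoped FintypeCatDiscrete Pointwise

universe u

variable {G : Type u} [Group G] [TopologicalSpace G] [IsTopologicalGroup G]

/-- A finite `G`-set is continuous iff every stabiliser is open (Mathlib's
`continuousSMul_iff_stabilizer_isOpen` along the definitional identification of
`Action.IsContinuous X` with `ContinuousSMul G X.V`). [folklore] -/
private theorem isContinuous_iff (X : Action FintypeCat.{u} G) :
    Action.IsContinuous X ↔ ∀ x : X.V, IsOpen (MulAction.stabilizer G x : Set G) := by
  constructor
  · intro h
    have h' : ContinuousSMul G X.V := h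
    exact continuousSMul_iff_stabilizer_isOpen.mp h'
  · intro h
    have h' : ContinuousSMul G X.V := continuousSMul_iff_stabilizer_isOpen.mpr h
    exact h'

omit [TopologicalSpace G] [IsTopologicalGroup G] in
/-- Equivariance of a morphism of `B(G)`, pointwise. [folklore] -/
private theorem hom_smul [TopologicalSpace G] {X Y : BCat G} (f : X ⟶ Y) (g : G) (x : X.obj.V) :
    f.hom.hom (g • x) = g • f.hom.hom x := by
  have e := ConcreteCategory.congr_hom (f.hom.comm g) x
  simp only [FintypeCat.comp_apply] at e
  exact e

/-- The finite coset `G`-set `G ⧸ K` of an open subgroup of finite index is continuous: the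
stabiliser of `gK` is the open subgroup `gKg⁻¹`. [folklore] -/
private theorem isContinuous_quot (K : Subgroup G) [Finite (G ⧸ K)] (hK : IsOpen (K : Set G)) :
    Action.IsContinuous (G ⧸ₐ K) := by
  rw [isContinuous_iff]
  intro q
  obtain ⟨g₀, hg₀⟩ := QuotientGroup.mk_surjective (q : G ⧸ K)
  have key : (MulAction.stabilizer G q : Set G) = (fun g : G => g₀⁻¹ * g * g₀) ⁻¹' (K : Set G) := by
    ext g
    simp only [SetLike.mem_coe, MulAction.mem_stabilizer_iff, Set.mem_preimage]
    rw [← hg₀]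
    change (g • (g₀ : G ⧸ K) : G ⧸ K) = (g₀ : G ⧸ K) ↔ _
    rw [MulAction.Quotient.smul_coe, smul_eq_mul, eq_comm, QuotientGroup.eq, mul_assoc]
  have hopen : IsOpen ((fun g : G => g₀⁻¹ * g * g₀) ⁻¹' (K : Set G)) := hK.preimage (by fun_prop)
  exact (congrArg IsOpen key).mpr hopen

variable [CompactSpace G] [TotallyDisconnectedSpace G]

/-- (⇐) of `bCat_isSlim_iff_isSlimGroup`: if all open subgroups of the profinite group `G` have
trivial centraliser, then every forgetful functor `B(G)_A → B(G)` is rigid.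
[cite: MochizukiSemiAnbd2006, §0 p.6] -/
private theorem isSlim_of_isSlimGroup (hG : IsSlimGroup G) :
    Literature.AlgebraicGeometry.Frobenioids.IsSlim (BCat G) := by
  classical
  refine ⟨fun A α => ?_⟩
  have hA : ∀ a : A.obj.V, IsOpen (MulAction.stabilizer G a : Set G) :=
    (isContinuous_iff A.obj).mp A.property
  -- the pointed coset objects `(G/K, gK ↦ g • a)` over `A`
  let QV : OpenNormalSubgroup G → BCat G := fun K =>
    ⟨G ⧸ₐ K.toSubgroup, isContinuous_quot K.toSubgroup K.isOpen'⟩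
  let Qf : ∀ (a : A.obj.V) (K : OpenNormalSubgroup G),
      K.toSubgroup ≤ MulAction.stabilizer G a → (QV K ⟶ A) := fun a K hK =>
    ObjectProperty.homMk
      { hom := FintypeCat.homMk fun q : G ⧸ K.toSubgroup =>
          Quotient.liftOn' q (fun g : G => g • a) fun g g' h => by
            have h' : g⁻¹ * g' ∈ K.toSubgroup := QuotientGroup.leftRel_apply.mp h
            have := hK h'
            rw [MulAction.mem_stabilizer_iff, mul_smul, inv_smul_eq_iff] at this
            exact this.symm
        comm := fun x => by
          apply FintypeCat.hom_ext
          intro q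
          obtain ⟨g, rfl⟩ := QuotientGroup.mk_surjective (q : G ⧸ K.toSubgroup)
          simp only [FintypeCat.comp_apply, FintypeCat.homMk_apply]
          change Quotient.liftOn' (x • (g : G ⧸ K.toSubgroup) : G ⧸ K.toSubgroup) _ _ =
            x • (g • a)
          rw [MulAction.Quotient.smul_coe, smul_eq_mul]
          exact mul_smul x g a }
  have Qf_mk : ∀ a K hK (g : G),
      (Qf a K hK).hom.hom (((g : G ⧸ K.toSubgroup) : (QV K).obj.V)) = g • a :=
    fun a K hK g => rfl
  let Q : ∀ (a : A.obj.V) (K : OpenNormalSubgroup G),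
      K.toSubgroup ≤ MulAction.stabilizer G a → Over A := fun a K hK => Over.mk (Qf a K hK)
  -- the action of `α` on the base point of `Q a K`
  let ev : ∀ (a : A.obj.V) (K : OpenNormalSubgroup G),
      K.toSubgroup ≤ MulAction.stabilizer G a → G ⧸ K.toSubgroup → G ⧸ K.toSubgroup :=
    fun a K hK q => (α.hom.app (Q a K hK)).hom.hom q
  have ev_smul : ∀ a K hK (x : G) (q : G ⧸ K.toSubgroup),
      ev a K hK (x • q) = x • ev a K hK q := fun a K hK x q => by
    have := hom_smul (α.hom.app (Q a K hK)) x q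
    -- both actions are the coset action
    exact this
  -- naturality of `α`, pointwise
  have nat : ∀ {U V : Over A} (k : U ⟶ V) (v : U.left.obj.V),
      (α.hom.app V).hom.hom (k.left.hom.hom v) = k.left.hom.hom ((α.hom.app U).hom.hom v) :=
    fun {U V} k v => by
      have h := congrArg (fun φ : (Over.forget A).obj U ⟶ (Over.forget A).obj V => φ.hom.hom v)
        (α.hom.naturality k)
      exact h
  -- (1) monotonicity: naturality along the projection `G/K' → G/K`
  have mono : ∀ a (K K' : OpenNormalSubgroup G) hK hK' (hle : K'.toSubgroup ≤ K.toSubgroup) (n : G),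
      ev a K' hK' ((1 : G) : G ⧸ K'.toSubgroup) = (n : G ⧸ K'.toSubgroup) →
      ev a K hK ((1 : G) : G ⧸ K.toSubgroup) = (n : G ⧸ K.toSubgroup) := by
    intro a K K' hK hK' hle n hn
    -- the projection as a morphism over `A`
    let p : Q a K' hK' ⟶ Q a K hK := Over.homMk
      (ObjectProperty.homMk
        { hom := FintypeCat.homMk fun q : G ⧸ K'.toSubgroup =>
            Quotient.map' id (fun g g' h => by
              have h' : g⁻¹ * g' ∈ K'.toSubgroup := QuotientGroup.leftRel_apply.mp h
              exact QuotientGroup.leftRel_apply.mpr (hle h')) q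
          comm := fun x => by
            apply FintypeCat.hom_ext
            intro q
            obtain ⟨g, rfl⟩ := QuotientGroup.mk_surjective (q : G ⧸ K'.toSubgroup)
            simp only [FintypeCat.comp_apply, FintypeCat.homMk_apply]
            change Quotient.map' id _ (x • (g : G ⧸ K'.toSubgroup)) =
              (x • (g : G ⧸ K.toSubgroup) : G ⧸ K.toSubgroup)
            rw [MulAction.Quotient.smul_coe, smul_eq_mul, MulAction.Quotient.smul_coe, smul_eq_mul]
            rfl })
      (by
        apply ObjectProperty.hom_ext
        apply Action.hom_ext
        apply FintypeCat.hom_ext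
        intro q
        obtain ⟨g, rfl⟩ := QuotientGroup.mk_surjective (q : G ⧸ K'.toSubgroup)
        rfl)
    have h := nat p ((1 : G) : G ⧸ K'.toSubgroup)
    -- `p.left (1 K') = 1 K` and `p.left (n K') = n K`, definitionally
    have hn₁ : (α.hom.app (Q a K' hK')).hom.hom ((1 : G) : G ⧸ K'.toSubgroup) =
        (n : G ⧸ K'.toSubgroup) := hn
    rw [hn₁] at h
    exact h
  -- (2) naturality along right multiplication by `x ∈ Stab(a)`
  have conj : ∀ a (K : OpenNormalSubgroup G) hK (x : G) (hx : x ∈ MulAction.stabilizer G a) (n : G),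
      ev a K hK ((1 : G) : G ⧸ K.toSubgroup) = (n : G ⧸ K.toSubgroup) →
      ev a K hK (x : G ⧸ K.toSubgroup) = ((n * x : G) : G ⧸ K.toSubgroup) := by
    intro a K hK x hx n hn
    -- right multiplication by `x` as an endomorphism over `A`
    let r : Q a K hK ⟶ Q a K hK := Over.homMk
      (ObjectProperty.homMk
        { hom := FintypeCat.homMk fun q : G ⧸ K.toSubgroup =>
            Quotient.map' (fun g : G => g * x) (fun g g' h => by
              have h' : g⁻¹ * g' ∈ K.toSubgroup := QuotientGroup.leftRel_apply.mp h
              apply QuotientGroup.leftRel_apply.mpr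
              have : (g * x)⁻¹ * (g' * x) = x⁻¹ * (g⁻¹ * g') * x := by group
              rw [this]
              exact K.isNormal'.conj_mem' _ h' x) q
          comm := fun y => by
            apply FintypeCat.hom_ext
            intro q
            obtain ⟨g, rfl⟩ := QuotientGroup.mk_surjective (q : G ⧸ K.toSubgroup)
            simp only [FintypeCat.comp_apply, FintypeCat.homMk_apply]
            change Quotient.map' _ _ (y • (g : G ⧸ K.toSubgroup)) =
              (y • ((g * x : G) : G ⧸ K.toSubgroup) : G ⧸ K.toSubgroup)
            rw [MulAction.Quotient.smul_coe, smul_eq_mul, MulAction.Quotient.smul_coe, smul_eq_mul]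
            change (((y * g) * x : G) : G ⧸ K.toSubgroup) = ((y * (g * x) : G) : G ⧸ K.toSubgroup)
            rw [mul_assoc] })
      (by
        apply ObjectProperty.hom_ext
        apply Action.hom_ext
        apply FintypeCat.hom_ext
        intro q
        obtain ⟨g, rfl⟩ := QuotientGroup.mk_surjective (q : G ⧸ K.toSubgroup)
        change (Qf a K hK).hom.hom (((g * x : G) : G ⧸ K.toSubgroup) : (QV K).obj.V) =
          (Qf a K hK).hom.hom (((g : G) : G ⧸ K.toSubgroup) : (QV K).obj.V)
        rw [Qf_mk a K hK, Qf_mk a K hK, mul_smul, MulAction.mem_stabilizer_iff.mp hx])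
    have h := nat r ((1 : G) : G ⧸ K.toSubgroup)
    -- `r (1 K) = x K` and `r (n K) = n x K`, definitionally
    have hn₁ : (α.hom.app (Q a K hK)).hom.hom ((1 : G) : G ⧸ K.toSubgroup) =
        (n : G ⧸ K.toSubgroup) := hn
    rw [hn₁] at h
    have h' : ev a K hK (((1 : G) * x : G) : G ⧸ K.toSubgroup) = ((n * x : G) : G ⧸ K.toSubgroup) := h
    rw [one_mul] at h'
    exact h'
  -- (3) the key step: `α` fixes the base point of every `Q a K`
  have key : ∀ a (K : OpenNormalSubgroup G) hK,
      ev a K hK ((1 : G) : G ⧸ K.toSubgroup) = ((1 : G) : G ⧸ K.toSubgroup) := by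
    intro a K₀ hK₀
    -- index the open normal subgroups below `Stab(a)`
    let ι := {K : OpenNormalSubgroup G // K.toSubgroup ≤ MulAction.stabilizer G a}
    haveI : Nonempty ι := ⟨⟨K₀, hK₀⟩⟩
    let N : ι → Set G := fun K =>
      {n : G | ev a K.1 K.2 ((1 : G) : G ⧸ K.1.toSubgroup) = (n : G ⧸ K.1.toSubgroup)}
    have hNne : ∀ K, (N K).Nonempty := fun K => by
      obtain ⟨n, hn⟩ := QuotientGroup.mk_surjective (ev a K.1 K.2 ((1 : G) : G ⧸ K.1.toSubgroup))
      exact ⟨n, hn.symm⟩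
    have hNclosed : ∀ K, IsClosed (N K) := fun K => by
      obtain ⟨n₀, hn₀⟩ := hNne K
      have : N K = (fun n : G => n₀⁻¹ * n) ⁻¹' (K.1 : Set G) := by
        ext n
        simp only [Set.mem_setOf_eq, Set.mem_preimage, N, SetLike.mem_coe]
        rw [hn₀, QuotientGroup.eq]
        rfl
      rw [this]
      exact K.1.toOpenSubgroup.isClosed.preimage (by fun_prop)
    have hinf : ∀ (K K' : OpenNormalSubgroup G) (g : G), g ∈ (K ⊓ K').toSubgroup →
        g ∈ K.toSubgroup ∧ g ∈ K'.toSubgroup := fun K K' g hg => Subgroup.mem_inf.mp hg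
    have hdir : Directed (· ⊇ ·) N := fun K K' => by
      have hle : (K.1 ⊓ K'.1).toSubgroup ≤ MulAction.stabilizer G a :=
        fun g hg => K.2 (hinf _ _ g hg).1
      refine ⟨⟨K.1 ⊓ K'.1, hle⟩, ?_, ?_⟩
      · intro n hn
        exact mono a K.1 (K.1 ⊓ K'.1) K.2 hle (fun g hg => (hinf _ _ g hg).1) n hn
      · intro n hn
        exact mono a K'.1 (K.1 ⊓ K'.1) K'.2 hle (fun g hg => (hinf _ _ g hg).2) n hn
    obtain ⟨n, hn⟩ := IsCompact.nonempty_iInter_of_directed_nonempty_isCompact_isClosed N hdir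
      hNne (fun K => (hNclosed K).isCompact) hNclosed
    have hn' : ∀ K : ι, n ∈ N K := fun K => Set.mem_iInter.mp hn K
    -- `n` commutes with `Stab(a)` modulo every `K`, hence on the nose
    have hcomm : ∀ x ∈ MulAction.stabilizer G a, x * n = n * x := by
      intro x hx
      -- the commutator `(n x)⁻¹ (x n)` lies in every open normal `K ≤ Stab(a)`
      have hmem : ∀ K : ι, (n * x)⁻¹ * (x * n) ∈ K.1.toSubgroup := fun K => by
        have h1 : ev a K.1 K.2 (x : G ⧸ K.1.toSubgroup) = ((n * x : G) : G ⧸ K.1.toSubgroup) :=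
          conj a K.1 K.2 x hx n (hn' K)
        have h2 : ev a K.1 K.2 (x : G ⧸ K.1.toSubgroup) = ((x * n : G) : G ⧸ K.1.toSubgroup) := by
          have := ev_smul a K.1 K.2 x ((1 : G) : G ⧸ K.1.toSubgroup)
          rw [MulAction.Quotient.smul_coe, smul_eq_mul, mul_one, hn' K,
            MulAction.Quotient.smul_coe, smul_eq_mul] at this
          exact this
        rw [h2] at h1
        exact QuotientGroup.eq.mp h1.symm
      -- hence it is trivial, open normal subgroups below `Stab(a)` separating points
      by_contra hne
      have hne' : (n * x)⁻¹ * (x * n) ≠ 1 := by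
        intro h
        apply hne
        rw [inv_mul_eq_one] at h
        exact h.symm
      obtain ⟨K₁, hK₁⟩ := ProfiniteGrp.exist_openNormalSubgroup_sub_open_nhds_of_one
        (isOpen_compl_singleton (x := (n * x)⁻¹ * (x * n)))
        (show (1 : G) ∈ ({(n * x)⁻¹ * (x * n)}ᶜ : Set G) from fun h => hne' h.symm)
      have h := hmem ⟨K₁ ⊓ K₀, fun g hg => hK₀ (hinf _ _ g hg).2⟩
      exact hK₁ (hinf _ _ _ h).1 rfl
    have hn1 : n = 1 := by
      have hz : n ∈ Subgroup.centralizer ((MulAction.stabilizer G a : Subgroup G) : Set G) := by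
        rw [Subgroup.mem_centralizer_iff]
        intro x hx
        exact hcomm x hx
      rw [hG.centralizer_eq_bot _ (hA a)] at hz
      exact hz
    have := hn' ⟨K₀, hK₀⟩
    rw [hn1] at this
    exact this
  -- (4) conclusion: `α` is the identity on every point of every object over `A`
  apply Iso.ext
  apply NatTrans.ext
  funext U
  rw [Iso.refl_hom, NatTrans.id_app]
  apply ObjectProperty.hom_ext
  apply Action.hom_ext
  apply FintypeCat.hom_ext
  intro b
  change (α.hom.app U).hom.hom b = b
  have hb : IsOpen (MulAction.stabilizer G b : Set G) :=
    (isContinuous_iff U.left.obj).mp U.left.property b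
  obtain ⟨K, hK⟩ := ProfiniteGrp.exist_openNormalSubgroup_sub_open_nhds_of_one hb
    (MulAction.stabilizer G b).one_mem
  have hKb : K.toSubgroup ≤ MulAction.stabilizer G b := fun g hg => hK hg
  let a : A.obj.V := U.hom.hom.hom b
  have hKa : K.toSubgroup ≤ MulAction.stabilizer G a := fun g hg => by
    rw [MulAction.mem_stabilizer_iff]
    have e := hom_smul U.hom g b
    exact e.symm.trans (congrArg (fun c => U.hom.hom.hom c) (MulAction.mem_stabilizer_iff.mp (hKb hg)))
  -- the orbit map `G/K → B`, `gK ↦ g • b`, over `A`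
  let φ : Q a K hKa ⟶ U := Over.homMk
    (ObjectProperty.homMk
      { hom := FintypeCat.homMk fun q : G ⧸ K.toSubgroup =>
          Quotient.liftOn' q (fun g : G => g • b) fun g g' h => by
            have h' : g⁻¹ * g' ∈ K.toSubgroup := QuotientGroup.leftRel_apply.mp h
            have := hKb h'
            rw [MulAction.mem_stabilizer_iff, mul_smul, inv_smul_eq_iff] at this
            exact this.symm
        comm := fun x => by
          apply FintypeCat.hom_ext
          intro q
          obtain ⟨g, rfl⟩ := QuotientGroup.mk_surjective (q : G ⧸ K.toSubgroup)
          simp only [FintypeCat.comp_apply, FintypeCat.homMk_apply]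
          change Quotient.liftOn' (x • (g : G ⧸ K.toSubgroup) : G ⧸ K.toSubgroup) _ _ =
            x • (g • b)
          rw [MulAction.Quotient.smul_coe, smul_eq_mul]
          exact mul_smul x g b })
    (by
      apply ObjectProperty.hom_ext
      apply Action.hom_ext
      apply FintypeCat.hom_ext
      intro q
      obtain ⟨g, rfl⟩ := QuotientGroup.mk_surjective (q : G ⧸ K.toSubgroup)
      change U.hom.hom.hom (g • b) = g • U.hom.hom.hom b
      exact hom_smul U.hom g b)
  have h := nat φ ((1 : G) : G ⧸ K.toSubgroup)
  change (α.hom.app U).hom.hom ((1 : G) • b) = Quotient.liftOn' (ev a K hKa _) _ _ at h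
  rw [key a K hKa, one_smul] at h
  rw [h]
  exact one_smul G b

/-- (⇒) of `bCat_isSlim_iff_isSlimGroup`: if every forgetful functor `B(G)_A → B(G)` is rigid, then
open subgroups `H` of the profinite group `G` have trivial centraliser — an element
`z ∈ Z_G(H)` defines the natural automorphism `b ↦ (g z g⁻¹) · b` (`b ↦ gH` the structure map to
`A = G/H`) of `B(G)_A → B(G)`, which moves the base point of `(G/K → G/H)` unless `z ∈ K`
(the Hausdorff hypothesis of the named fact is not needed). [cite: MochizukiSemiAnbd2006, §0 p.6] -/
private theorem isSlimGroup_of_isSlim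
    (hslim : Literature.AlgebraicGeometry.Frobenioids.IsSlim (BCat G)) : IsSlimGroup G := by
  classical
  refine ⟨fun H hH => ?_⟩
  rw [eq_bot_iff]
  intro z hz
  rw [Subgroup.mem_bot]
  by_contra hz1
  -- an open normal subgroup `K ≤ H` missing `z`
  obtain ⟨K, hK⟩ := ProfiniteGrp.exist_openNormalSubgroup_sub_open_nhds_of_one
    (hH.inter (isOpen_compl_singleton (x := z))) ⟨H.one_mem, fun h => hz1 h.symm⟩
  have hKH : K.toSubgroup ≤ H := fun g hg => (hK hg).1
  have hzK : z ∉ K.toSubgroup := fun h => (hK h).2 rfl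
  -- the base object `A = G/H`
  haveI : Finite (G ⧸ H) := Subgroup.quotient_finite_of_isOpen H hH
  let A : BCat G := ⟨G ⧸ₐ H, isContinuous_quot H hH⟩
  -- the conjugates `θ(gH) = g z g⁻¹` of `z`, well defined since `z` centralises `H`
  let θ : G ⧸ H → G := fun q => q.out * z * q.out⁻¹
  have θ_mk : ∀ g : G, θ (g : G ⧸ H) = g * z * g⁻¹ := fun g => by
    obtain ⟨h, hh⟩ := QuotientGroup.mk_out_eq_mul H g
    have hc : (h : G) * z = z * h := Subgroup.mem_centralizer_iff.mp hz h h.2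
    change (g : G ⧸ H).out * z * ((g : G ⧸ H).out)⁻¹ = g * z * g⁻¹
    rw [hh]
    calc g * ↑h * z * (g * ↑h)⁻¹ = g * (↑h * z) * (↑h)⁻¹ * g⁻¹ := by group
      _ = g * (z * ↑h) * (↑h)⁻¹ * g⁻¹ := by rw [hc]
      _ = g * z * g⁻¹ := by group
  have θ_smul : ∀ (x : G) (q : G ⧸ H), θ (x • q) = x * θ q * x⁻¹ := fun x q => by
    obtain ⟨g, rfl⟩ := QuotientGroup.mk_surjective q
    rw [MulAction.Quotient.smul_coe, smul_eq_mul, θ_mk, θ_mk]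
    group
  have θ_self : ∀ q : G ⧸ H, θ (θ q • q) = θ q := fun q => by
    obtain ⟨g, rfl⟩ := QuotientGroup.mk_surjective q
    rw [θ_mk, MulAction.Quotient.smul_coe, smul_eq_mul, θ_mk]
    group
  have θ_inv_self : ∀ q : G ⧸ H, θ ((θ q)⁻¹ • q) = θ q := fun q => by
    obtain ⟨g, rfl⟩ := QuotientGroup.mk_surjective q
    rw [θ_mk, MulAction.Quotient.smul_coe, smul_eq_mul, θ_mk]
    group
  -- the structure map of an object over `A`, on points, and its equivariance
  let str : ∀ U : Over A, U.left.obj.V → G ⧸ H := fun U b => U.hom.hom.hom b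
  have str_smul : ∀ (U : Over A) (x : G) (b : U.left.obj.V), str U (x • b) = x • str U b :=
    fun U x b => hom_smul U.hom x b
  have str_map : ∀ {U V : Over A} (k : U ⟶ V) (b : U.left.obj.V),
      str V (k.left.hom.hom b) = str U b := fun {U V} k b => by
    have h := congrArg (fun φ : U.left ⟶ A => φ.hom.hom b) (Over.w k)
    exact h
  -- the permutation `b ↦ θ(f b) • b` of each object over `A`
  let σ : ∀ U : Over A, U.left.obj.V ≃ U.left.obj.V := fun U =>
    { toFun := fun b => θ (str U b) • b
      invFun := fun b => (θ (str U b))⁻¹ • b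
      left_inv := fun b => by
        change (θ (str U (θ (str U b) • b)))⁻¹ • θ (str U b) • b = b
        rw [str_smul, θ_self, inv_smul_smul]
      right_inv := fun b => by
        change θ (str U ((θ (str U b))⁻¹ • b)) • (θ (str U b))⁻¹ • b = b
        rw [str_smul, θ_inv_self, smul_inv_smul] }
  have σ_apply : ∀ (U : Over A) (b : U.left.obj.V), σ U b = θ (str U b) • b := fun U b => rfl
  -- ... as a natural automorphism of the forgetful functor `B(G)_A → B(G)`
  let ι : ∀ U : Over A, U.left ≅ U.left := fun U =>
    ObjectProperty.isoMk _ (Action.mkIso (FintypeCat.equivEquivIso (σ U)) fun x => by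
      apply FintypeCat.hom_ext
      intro b
      change σ U (x • b) = x • σ U b
      rw [σ_apply, σ_apply, str_smul, θ_smul, smul_smul, smul_smul, inv_mul_cancel_right])
  let α : Over.forget A ≅ Over.forget A := NatIso.ofComponents (fun U => ι U) fun {U V} k => by
    apply ObjectProperty.hom_ext
    apply Action.hom_ext
    apply FintypeCat.hom_ext
    intro b
    change σ V (k.left.hom.hom b) = k.left.hom.hom (σ U b)
    rw [σ_apply, σ_apply, str_map, hom_smul]
  -- rigidity: `α` is the identity, in particular on the base point of `G/K → G/H`
  have hrig := hslim.isRigid_forget A α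
  let QK : BCat G := ⟨G ⧸ₐ K.toSubgroup, isContinuous_quot K.toSubgroup K.isOpen'⟩
  let π : QK ⟶ A := ObjectProperty.homMk
    { hom := FintypeCat.homMk fun q : G ⧸ K.toSubgroup =>
        Quotient.map' id (fun g g' h => by
          have h' : g⁻¹ * g' ∈ K.toSubgroup := QuotientGroup.leftRel_apply.mp h
          exact QuotientGroup.leftRel_apply.mpr (hKH h')) q
      comm := fun x => by
        apply FintypeCat.hom_ext
        intro q
        obtain ⟨g, rfl⟩ := QuotientGroup.mk_surjective (q : G ⧸ K.toSubgroup)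
        simp only [FintypeCat.comp_apply, FintypeCat.homMk_apply]
        change Quotient.map' id _ (x • (g : G ⧸ K.toSubgroup)) = (x • (g : G ⧸ H) : G ⧸ H)
        rw [MulAction.Quotient.smul_coe, smul_eq_mul, MulAction.Quotient.smul_coe, smul_eq_mul]
        rfl }
  have h := congrArg (fun β : Over.forget A ≅ Over.forget A =>
    (β.hom.app (Over.mk π)).hom.hom ((1 : G) : G ⧸ K.toSubgroup)) hrig
  change θ ((1 : G) : G ⧸ H) • ((1 : G) : G ⧸ K.toSubgroup) = ((1 : G) : G ⧸ K.toSubgroup) at h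
  rw [θ_mk, one_mul, inv_one, mul_one] at h
  change ((z * 1 : G) : G ⧸ K.toSubgroup) = ((1 : G) : G ⧸ K.toSubgroup) at h
  rw [mul_one, QuotientGroup.eq, mul_one] at h
  exact hzK (inv_mem_iff.mp h)

/-- NAMED FACT `bCat_isSlim_iff_isSlimGroup` ([SemiAnbd] §0 p. 6), PROVED: for a profinite group
`G`, the connected anabelioid `B(G)` is slim (all `B(G)_A → B(G)` rigid) iff every open subgroup
of `G` has trivial centraliser. [cite: MochizukiSemiAnbd2006, §0 p.6] -/
theorem bCat_isSlim_iff_isSlimGroup_holds : bCat_isSlim_iff_isSlimGroup := by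
  intro G _ _ _ _ _ _
  exact ⟨isSlimGroup_of_isSlim, isSlim_of_isSlimGroup⟩

end Literature.AnabelianGeometry.Anabelioids
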